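import Literature.AlgebraicGeometry.Resolution.BlowupAlgebraPresentation
import Literature.AlgebraicGeometry.Resolution.QuadraticTransformsRegular
import Literature.AlgebraicGeometry.Resolution.LocalBlowup
import Mathlib.RingTheory.IntegralClosure.IntegrallyClosed
import Mathlib.RingTheory.Localization.Away.Basic
import HarnessLib

/-!
# «Low order is absorbing» at `p = 2` — chart plumbing (chain W4.1, crux `Steer`, §σ2.17/§σ2.19)

OURS (campaign res-hironaka, rung L, slot W4.1; helper for crux `Steer` stmt-ResolutionOfSingularities-16345,
one-step lemma `lowOrder_step_two` of res-L0-w41-tri-2). Route-independent commutative algebra for the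
chart `R[P/cᵢ] ⊆ K` of a local blowing up, realised INSIDE the field `K` as the image of the
polynomial ring `R[T_j : j ≠ i]` under `Ev : T_j ↦ c_j/cᵢ`:

* `theta_injective`, `ev_eq_comp` — `Ev` factors through the abstract affine blowup algebra
  `R[I/cᵢ] ⊆ R[1/cᵢ]` (`blowupAlgebra`, tree) followed by the injection `R[1/cᵢ] → K`;
* `mem_map_C_of_ev_eq_zero` — **relations of the chart have coefficients in `P`**: `Ev G = 0 ⇒
  G ∈ P · R[T]` for `c` quasi-regular (Stacks 0BIQ via the tree's `eval_mem_span_algebraMap_iff'`);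
* `exists_rep_of_mem_pow` — elements of `𝔪'ⁿ` of the local ring `B_{𝔪_O ∩ B}` at the centre of a
  valuation ring `O`, `B = φ(A)`, are fractions `φ ã / φ ũ` with `ã ∈ 𝔑ⁿ`, `ν(φ ũ) = 0`, where
  `𝔑 = φ⁻¹(𝔪_O)`;
* `mem_of_sq_mem_of_isRegularLocalRing` — a quotient `p/q` of elements of a regular local subring
  `R' ⊆ K` whose square lies in `R'` lies in `R'` (normality).

No definitions; NOT a statement of any manuscript. [cite: StacksProject, Tag 0BIQ]
[cite: NovacoskiSpivakovsky2014, Def. 2.11] [cite: Matsumura1987, Thm. 19.4]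
-/

noncomputable section

-- `Summit.<S>.<S>.…` duplicates the summit name by design (single-problem summit).
set_option linter.dupNamespace false

open IsLocalRing Literature.AlgebraicGeometry.Resolution

namespace Summit.ResolutionOfSingularities.ResolutionOfSingularities.Theorems.SwitchingDichotomy.LowOrderAbsorbing

universe u

variable {K : Type u} [Field K]

/-! ## The chart ring as an image of a polynomial ring -/

section Chart

variable (R : Subring K) {r : ℕ} (c : Fin r → R) (i : Fin r)

/-- The injection `R[1/cᵢ] → K` (for `cᵢ ≠ 0`) is injective. [folklore] -/
theorem theta_injective (hci : ((c i : R) : K) ≠ 0) :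
    Function.Injective (IsLocalization.Away.lift (S := Localization.Away (c i)) (c i)
      (isUnit_iff_ne_zero.mpr hci : IsUnit (R.subtype (c i)))) := by
  set θ := IsLocalization.Away.lift (S := Localization.Away (c i)) (c i)
      (isUnit_iff_ne_zero.mpr hci : IsUnit (R.subtype (c i))) with hθ
  rw [injective_iff_map_eq_zero]
  intro z hz
  obtain ⟨⟨a, s⟩, rfl⟩ := IsLocalization.mk'_surjective (Submonoid.powers (c i)) z
  rw [hθ, IsLocalization.Away.lift, IsLocalization.lift_mk', mul_eq_zero] at hz
  rcases hz with ha | hs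
  · have ha0 : a = 0 := Subtype.ext (by simpa using ha)
    change IsLocalization.mk' (Localization.Away (c i)) a s = 0
    rw [ha0, IsLocalization.mk'_zero]
  · exfalso
    exact (Units.ne_zero _) hs

/-- The realisation `Ev : R[T_j : j ≠ i] → K`, `T_j ↦ c_j/cᵢ`, factors as `θ ∘ (R[I/cᵢ] ⊆ R[1/cᵢ]) ∘ eval`.
[folklore] -/
theorem ev_eq_comp (hci : ((c i : R) : K) ≠ 0) :
    MvPolynomial.eval₂Hom R.subtype (fun j : {j : Fin r // j ≠ i} => ((c j.1 : R) : K) / (c i : R)) =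
      (((IsLocalization.Away.lift (S := Localization.Away (c i)) (c i)
        (isUnit_iff_ne_zero.mpr hci : IsUnit (R.subtype (c i)))).comp
        (blowupAlgebra (Ideal.span (Set.range c)) (c i)).val.toRingHom).comp
        (blowupAlgebra.eval c i).toRingHom) := by
  have hunit : IsUnit (R.subtype (c i)) := isUnit_iff_ne_zero.mpr hci
  set θ := IsLocalization.Away.lift (S := Localization.Away (c i)) (c i) hunit with hθ
  rw [blowupAlgebra.comp_val_comp_eval]
  have halg : θ.comp (algebraMap R (Localization.Away (c i))) = R.subtype := by
    ext a
    rw [RingHom.comp_apply, hθ, IsLocalization.Away.lift_eq]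
  have hinv : θ (IsLocalization.Away.invSelf (c i)) = (((c i : R) : K))⁻¹ := by
    apply eq_inv_of_mul_eq_one_left
    have h1 : θ (algebraMap R (Localization.Away (c i)) (c i)) = ((c i : R) : K) := by
      rw [hθ, IsLocalization.Away.lift_eq]; rfl
    rw [← h1, ← map_mul, mul_comm, IsLocalization.Away.mul_invSelf, map_one]
  have hfrac : (fun j : {j : Fin r // j ≠ i} => θ ↑(blowupAlgebra.frac c i j.1)) =
      fun j : {j : Fin r // j ≠ i} => ((c j.1 : R) : K) / (c i : R) := by
    funext j
    rw [blowupAlgebra.coe_frac, map_mul, hinv, div_eq_mul_inv]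
    congr 1
    rw [hθ, IsLocalization.Away.lift_eq]; rfl
  rw [halg, hfrac]

/-- **Relations of the chart have coefficients in `P`** (Stacks 0BIQ, realised in `K`): for a
quasi-regular `c` with `cᵢ ≠ 0`, a polynomial `G ∈ R[T_j : j ≠ i]` with `G(c/cᵢ) = 0` in `K` has all
its coefficients in `P = (c)`. [cite: StacksProject, Tag 0BIQ] -/
theorem mem_map_C_of_ev_eq_zero (hci : ((c i : R) : K) ≠ 0) (hqr : IsQuasiRegular c)
    {G : MvPolynomial {j : Fin r // j ≠ i} R}
    (hG : MvPolynomial.eval₂Hom R.subtype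
      (fun j : {j : Fin r // j ≠ i} => ((c j.1 : R) : K) / (c i : R)) G = 0) :
    G ∈ Ideal.map MvPolynomial.C (Ideal.span (Set.range c)) := by
  rw [ev_eq_comp R c i hci] at hG
  rw [← blowupAlgebra.eval_mem_span_algebraMap_iff' c i hqr]
  have h0 : blowupAlgebra.eval c i G = 0 := by
    have hinj := theta_injective R c i hci
    rw [RingHom.comp_apply, RingHom.comp_apply] at hG
    have h1 : ((blowupAlgebra (Ideal.span (Set.range c)) (c i)).val.toRingHom
        ((blowupAlgebra.eval c i).toRingHom G)) = 0 := hinj (by rw [hG, map_zero])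
    exact Subtype.ext (by simpa using h1)
  rw [h0]
  exact Ideal.zero_mem _

/-- The image of `Ev` is the chart ring `R[c/cᵢ] ⊆ K`. [folklore] -/
theorem range_ev (hci : ((c i : R) : K) ≠ 0) :
    (MvPolynomial.eval₂Hom R.subtype
      (fun j : {j : Fin r // j ≠ i} => ((c j.1 : R) : K) / (c i : R))).range =
      Subring.closure ((R : Set K) ∪ (fun y : R => (y : K) / (c i : R)) '' Set.range c) := by
  classical
  apply le_antisymm
  · rintro _ ⟨G, rfl⟩
    induction G using MvPolynomial.induction_on with
    | C a =>
      rw [MvPolynomial.coe_eval₂Hom, MvPolynomial.eval₂_C]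
      exact Subring.subset_closure (Or.inl a.2)
    | add p q hp hq => rw [map_add]; exact Subring.add_mem _ hp hq
    | mul_X p j hp =>
      rw [map_mul, MvPolynomial.coe_eval₂Hom, MvPolynomial.eval₂_X]
      exact Subring.mul_mem _ hp (Subring.subset_closure (Or.inr ⟨c j.1, ⟨j.1, rfl⟩, rfl⟩))
  · refine Subring.closure_le.mpr ?_
    rintro z (hz | ⟨y, ⟨j, rfl⟩, rfl⟩)
    · exact ⟨MvPolynomial.C ⟨z, hz⟩, by simp⟩
    · by_cases hj : j = i
      · subst hj
        refine ⟨1, ?_⟩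
        rw [map_one]
        exact (div_self hci).symm
      · exact ⟨MvPolynomial.X ⟨j, hj⟩, by simp⟩

end Chart

/-! ## Powers of the maximal ideal of the local ring at the centre -/

/-- **Representation of elements of `𝔪'ⁿ`.** Let `φ : A → K` be a ring map with image inside a
valuation ring `O`, `B = φ(A)`, `R' = B_{𝔪_O ∩ B}` (`locAtCentre`), `𝔑 = φ⁻¹(𝔪_O)`. Every element of
`(𝔪_{R'})ⁿ` is `φ ã / φ ũ` with `ã ∈ 𝔑ⁿ` and `ν(φ ũ) = 0`. [folklore] -/
theorem exists_rep_of_mem_pow {A : Type*} [CommRing A] (φ : A →+* K) (O : ValuationSubring K)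
    (hφO : ∀ a, φ a ∈ O) :
    haveI := isLocalRing_locAtCentre (B := φ.range) (O := O) (by rintro _ ⟨a, rfl⟩; exact hφO a)
    ∀ (n : ℕ) (z : locAtCentre φ.range O), z ∈ maximalIdeal (locAtCentre φ.range O) ^ n →
      ∃ a u : A, a ∈ ((maximalIdeal O).comap (φ.codRestrict O.toSubring hφO)) ^ n ∧
        O.valuation (φ u) = 1 ∧ (z : K) = φ a / φ u := by
  have hBO : φ.range ≤ O.toSubring := by rintro _ ⟨a, rfl⟩; exact hφO a
  haveI := isLocalRing_locAtCentre hBO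
  set N : Ideal A := (maximalIdeal O).comap (φ.codRestrict O.toSubring hφO) with hN
  have hNmem : ∀ a : A, a ∈ N ↔ O.valuation (φ a) < 1 := by
    intro a
    rw [hN, Ideal.mem_comap, ValuationSubring.valuation_lt_one_iff]
    rfl
  intro n
  induction n with
  | zero =>
    intro z _
    obtain ⟨y, ⟨a, rfl⟩, w, ⟨u, rfl⟩, hv, hz⟩ := (mem_locAtCentre_iff).1 z.2
    exact ⟨a, u, by simp, hv, hz⟩
  | succ n ih =>
    intro z hz
    rw [pow_succ] at hz
    refine Submodule.mul_induction_on hz ?_ ?_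
    · intro y hy w hw
      obtain ⟨a, u, ha, hu, hy'⟩ := ih y hy
      obtain ⟨y₂, ⟨b, rfl⟩, w₂, ⟨u', rfl⟩, hv', hw'⟩ := (mem_locAtCentre_iff).1 w.2
      have hb : b ∈ N := by
        rw [hNmem]
        have hlt := (mem_maximalIdeal_locAtCentre_iff hBO w).1 hw
        rw [hw', map_div₀, hv', div_one] at hlt
        exact hlt
      refine ⟨a * b, u * u', ?_, ?_, ?_⟩
      · rw [pow_succ]; exact Ideal.mul_mem_mul ha hb
      · rw [map_mul, map_mul, hu, hv', one_mul]
      · have : ((y * w : locAtCentre φ.range O) : K) = (y : K) * (w : K) := rfl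
        rw [this, hy', hw', map_mul, map_mul]
        have hu0 := ne_zero_of_valuation_eq_one hu
        have hu'0 := ne_zero_of_valuation_eq_one hv'
        field_simp
    · intro y w hy hw
      obtain ⟨a, u, ha, hu, hy'⟩ := hy
      obtain ⟨a', u', ha', hu', hw'⟩ := hw
      refine ⟨a * u' + a' * u, u * u', ?_, ?_, ?_⟩
      · exact Ideal.add_mem _ (Ideal.mul_mem_right _ _ ha) (Ideal.mul_mem_right _ _ ha')
      · rw [map_mul, map_mul, hu, hu', one_mul]
      · have : ((y + w : locAtCentre φ.range O) : K) = (y : K) + (w : K) := rfl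
        rw [this, hy', hw', map_add, map_mul, map_mul, map_mul]
        have hu0 := ne_zero_of_valuation_eq_one hu
        have hu'0 := ne_zero_of_valuation_eq_one hu'
        field_simp

/-! ## Normality of regular local subrings -/

/-- **A quotient `p / q` of elements of a regular local subring `R' ⊆ K` whose square lies in `R'`
lies in `R'`** (regular local rings are integrally closed, Matsumura Thm. 19.4). [cite: Matsumura1987, Thm. 19.4] -/
theorem mem_of_sq_mem_of_isRegularLocalRing (R' : Subring K) [IsRegularLocalRing R'] {p q : K}
    (hp : p ∈ R') (hq : q ∈ R') (hsq : (p / q) ^ 2 ∈ R') : p / q ∈ R' := by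
  haveI : IsDomain R' := inferInstance
  haveI : IsIntegrallyClosed R' := isIntegrallyClosed_of_isRegularLocalRing R'
  -- the canonical injection `Frac R' → K`
  have hinj : Function.Injective (algebraMap R' K) := Subtype.val_injective
  set φ : FractionRing R' →+* K := IsFractionRing.lift hinj with hφ
  have hφalg : ∀ y : R', φ (algebraMap R' (FractionRing R') y) = (y : K) := by
    intro y; rw [hφ, IsFractionRing.lift_algebraMap]; rfl
  -- the element `p/q` of `Frac R'`
  set β : FractionRing R' := algebraMap R' _ ⟨p, hp⟩ / algebraMap R' _ ⟨q, hq⟩ with hβ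
  have hφβ : φ β = p / q := by
    rw [hβ, map_div₀, hφalg, hφalg]
  have hβsq : β ^ 2 = algebraMap R' (FractionRing R') ⟨(p / q) ^ 2, hsq⟩ := by
    apply φ.injective
    rw [map_pow, hφβ, hφalg]
  have hint : IsIntegral R' β :=
    ⟨Polynomial.X ^ 2 - Polynomial.C ⟨(p / q) ^ 2, hsq⟩, Polynomial.monic_X_pow_sub_C _ two_ne_zero,
      by simp [hβsq]⟩
  obtain ⟨y, hy⟩ := IsIntegrallyClosed.algebraMap_eq_of_integral hint
  have : (y : K) = p / q := by rw [← hφalg y, hy, hφβ]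
  rw [← this]
  exact y.2

end Summit.ResolutionOfSingularities.ResolutionOfSingularities.Theorems.SwitchingDichotomy.LowOrderAbsorbing

end
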